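import Literature.Computability.AlgebraicComplexity.BI17TernaryQuarticDiagonalSupport
import Literature.Computability.AlgebraicComplexity.BI17TernaryStabilizerNormalForms
import HarnessLib

/-!
# A generic ternary quartic has trivial stabilizer (BI 2017 Thm. 2.3 at `(4,3)`, corrected)

Theorem-only file (cell `val-lit`, row BI2017-A; no definitions, no named facts).
**Main result** (`isZariskiGeneric_hasTrivialStabilizer_ternaryQuartic`): for a Zariski-generic
quartic form `f ∈ Sym⁴ ℂ³`, every `g ∈ GL₃(ℂ)` with `g · f = f` is a scalar `ζ I` with `ζ⁴ = 1`
(`HasTrivialStabilizer 4 f`); consequently `a(f) = 4`, `a'(f) = 1`. This is the case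
`(n, d) = (1, 4)` of Poonen 2005 Thm. 3 ("the generic hypersurface has `Lin X = {1}`"; for plane
quartics Chang 1978, Katz–Sarnak 10.6.18) in the language of Bürgisser–Ikenmeyer 2017 §2.1, i.e.
the CORRECTED `(D, m) = (4, 3)` clause of BI 2017 Thm. 2.3 / App. Prop. 7.5 (2) (the cell's
print-side erratum A21: the printed "`stab(w) ≃ C₂`, `a'(4,3) = 2`" is refuted in the tree,
`not_BI2017_prop_A_5`; here is the positive statement in its strong form `stab(w) = μ₄ · I`). It
discharges the hypothesis of the tree's conditional
`isZariskiGeneric_hasTrivialStabilizer_ternaryQuartic_of_poonen2005_thm_3`.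

## Proof (dimension count; no invariant theory, no curve theory)

A non-scalar `g` stabilizing `f` is conjugate, `g P = P T`, to one of four normal forms
(`exists_conj_normalForm_fin_three`), and `f̃ = P⁻¹ · f` is `T`-stable:
* (D3) `T` diagonal with distinct entries: `f̃` has `≤ 6` monomials
  (`card_support_le_six_of_diagonal`); normalising one column of `P` by the torus centraliser,
  `f = P · f̃` lies in a `6 + 8 = 14`-parameter polynomial family;
* (D2) `T = diag(λ, λ, μ)`: `≤ 9` monomials (`card_support_le_nine_of_diagonal`); column-reducing
  two columns of `P` by the centraliser `GL₂`: `9 + 5 = 14` parameters;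
* (U1) a Jordan block of size `2`: `f̃ ∈ ℂ[x₀, x₁]₄` (`apply_two_eq_zero_of_jordan_smul`):
  `5 + 6 = 11` parameters;
* (U2) a Jordan block of size `3`: `f̃ ∈ span{x₀⁴, x₀² q, q²}`
  (`exists_eq_of_unipotent_fixed_quartic`, `eq_zero_of_smul_unipotent_smul`): `3 + 9 = 12`.
Each family has fewer than `15 = dim Sym⁴ ℂ³` parameters, so misses a hypersurface (the tree's
`exists_ne_zero_aeval_formCoeff_map_eq_zero`, transcendence degree); the product of these
hypersurface equations is the genericity polynomial. Honest framing: classical (Matsumura–Monsky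
style) bookkeeping; nothing here bears on VP versus VNP.

## References

* [BurgisserIkenmeyer2017] P. Bürgisser, C. Ikenmeyer, *Fundamental invariants of orbit closures*,
  J. Algebra 477 (2017) 390–434, §2.1 Thm. 2.3, Appendix Prop. 7.5 (2).
* [Poonen2005] B. Poonen, *Varieties without extra automorphisms III: hypersurfaces*, Finite
  Fields Appl. 11 (2005), Thm. 3.
-/

noncomputable section

open MvPolynomial
open scoped BigOperators

namespace Literature.Computability.AlgebraicComplexity

/-! ### §1 Transfer along a conjugation and charts -/

section Charts

/-- **Transfer of a stabilizer element along `g P = P T`** (ternary version of the tree's binary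
`linSubst_inv_of_mul_eq_mul`): `T` stabilizes `f̃ = P⁻¹ · f` and `f = P · f̃`.
[cite: BurgisserIkenmeyer2017, §7 (Appendix) Prop. 7.5] -/
theorem linSubst_inv_of_mul_eq_mul_fin_three {g P T : Matrix (Fin 3) (Fin 3) ℂ} (hP : P.det ≠ 0)
    (hgP : g * P = P * T) {f : MvPolynomial (Fin 3) ℂ} (hgf : linSubst (Fin 3) ℂ g f = f) :
    linSubst (Fin 3) ℂ T (linSubst (Fin 3) ℂ P⁻¹ f) = linSubst (Fin 3) ℂ P⁻¹ f ∧
      linSubst (Fin 3) ℂ P (linSubst (Fin 3) ℂ P⁻¹ f) = f := by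
  have hPu : IsUnit P.det := isUnit_iff_ne_zero.mpr hP
  have hTP : T * P⁻¹ = P⁻¹ * g := by
    calc T * P⁻¹ = P⁻¹ * P * T * P⁻¹ := by rw [Matrix.nonsing_inv_mul _ hPu, Matrix.one_mul]
      _ = P⁻¹ * (g * P) * P⁻¹ := by rw [Matrix.mul_assoc P⁻¹ P T, ← hgP]
      _ = P⁻¹ * g := by rw [Matrix.mul_assoc, Matrix.mul_assoc, Matrix.mul_nonsing_inv _ hPu,
          Matrix.mul_one]
  constructor
  · rw [← AlgHom.comp_apply, ← linSubst_mul, hTP, linSubst_mul, AlgHom.comp_apply, hgf]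
  · rw [← AlgHom.comp_apply, ← linSubst_mul, Matrix.mul_nonsing_inv _ hPu, linSubst_one,
      AlgHom.id_apply]

/-- The diagonal entries of a normal form conjugate to an invertible matrix are nonzero.
[cite: BurgisserIkenmeyer2017, §7 (Appendix) Prop. 7.5] -/
theorem diag_ne_zero_of_conj {g P : Matrix (Fin 3) (Fin 3) ℂ} (hg : g.det ≠ 0) (hP : P.det ≠ 0)
    {t₀₀ t₀₁ t₀₂ t₁₁ t₁₂ t₂₂ : ℂ} (hgP : g * P = P * !![t₀₀, t₀₁, t₀₂; 0, t₁₁, t₁₂; 0, 0, t₂₂]) :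
    t₀₀ ≠ 0 ∧ t₁₁ ≠ 0 ∧ t₂₂ ≠ 0 := by
  have h := congrArg Matrix.det hgP
  rw [Matrix.det_mul, Matrix.det_mul] at h
  have hdet : (!![t₀₀, t₀₁, t₀₂; 0, t₁₁, t₁₂; 0, 0, t₂₂] : Matrix (Fin 3) (Fin 3) ℂ).det =
      t₀₀ * t₁₁ * t₂₂ := by
    rw [Matrix.det_fin_three]; simp
  rw [hdet] at h
  have hne : t₀₀ * t₁₁ * t₂₂ ≠ 0 := by
    intro h0
    rw [h0, mul_zero] at h
    exact mul_ne_zero hg hP h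
  exact ⟨fun h0 => hne (by rw [h0]; ring), fun h0 => hne (by rw [h0]; ring),
    fun h0 => hne (by rw [h0]; ring)⟩

/-- **Chart for the torus centraliser**: if `g P = P T` with `T` diagonal then, rescaling the first
column of `P` (a nonzero vector) by the torus, `g P' = P' T` with `P'_{p0} = 1` for some row `p`.
[cite: BurgisserIkenmeyer2017, §7 (Appendix) Prop. 7.5] -/
theorem exists_conj_col_zero_eq_one {g P : Matrix (Fin 3) (Fin 3) ℂ} (hP : P.det ≠ 0) {l₀ l₁ l₂ : ℂ}
    (hgP : g * P = P * !![l₀, 0, 0; 0, l₁, 0; 0, 0, l₂]) :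
    ∃ (P' : Matrix (Fin 3) (Fin 3) ℂ) (p : Fin 3), P'.det ≠ 0 ∧
      g * P' = P' * !![l₀, 0, 0; 0, l₁, 0; 0, 0, l₂] ∧ P' p 0 = 1 := by
  -- a nonzero entry of the first column
  obtain ⟨p, hp⟩ : ∃ p, P p 0 ≠ 0 := by
    by_contra h
    push Not at h
    apply hP
    rw [Matrix.det_fin_three, h 0, h 1, h 2]
    ring
  set C : Matrix (Fin 3) (Fin 3) ℂ := !![(P p 0)⁻¹, 0, 0; 0, 1, 0; 0, 0, 1] with hC
  refine ⟨P * C, p, ?_, ?_, ?_⟩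
  · rw [Matrix.det_mul]
    refine mul_ne_zero hP ?_
    simp [hC, Matrix.det_fin_three, inv_ne_zero hp]
  · have hcomm : (!![l₀, 0, 0; 0, l₁, 0; 0, 0, l₂] : Matrix (Fin 3) (Fin 3) ℂ) * C =
        C * !![l₀, 0, 0; 0, l₁, 0; 0, 0, l₂] := by
      ext i j; fin_cases i <;> fin_cases j <;> simp [hC, Matrix.mul_apply, Fin.sum_univ_three, mul_comm]
    rw [← Matrix.mul_assoc, hgP, Matrix.mul_assoc, hcomm, Matrix.mul_assoc]
  · simp only [Matrix.mul_apply, Fin.sum_univ_three, hC, Matrix.of_apply, Matrix.cons_val',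
      Matrix.cons_val_zero, Matrix.cons_val_one, Matrix.empty_val', Matrix.cons_val_fin_one,
      Matrix.cons_val_two, Matrix.tail_cons, Matrix.head_fin_const, mul_zero, add_zero]
    exact mul_inv_cancel₀ hp


/-- Laplace expansion of a `3 × 3` determinant along the last column in terms of the `2 × 2` minors
of the first two columns. [cite: BurgisserIkenmeyer2017, §7 (Appendix) Prop. 7.5] -/
theorem det_eq_zero_of_minors_eq_zero {P : Matrix (Fin 3) (Fin 3) ℂ}
    (h12 : P 1 0 * P 2 1 - P 1 1 * P 2 0 = 0) (h02 : P 0 0 * P 2 1 - P 0 1 * P 2 0 = 0)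
    (h01 : P 0 0 * P 1 1 - P 0 1 * P 1 0 = 0) : P.det = 0 := by
  rw [Matrix.det_fin_three]
  linear_combination P 0 2 * h12 - P 1 2 * h02 + P 2 2 * h01

/-- **Chart for the centraliser `GL₂ × GL₁` of `diag(λ, λ, μ)`**, one pair of pivot rows: if the
`2 × 2` minor of the first two columns of `P` in rows `i ≠ j` is nonzero, right multiplication by
a block matrix commuting with `diag(λ, λ, μ)` makes these two columns reduced
(`P'_{i0} = 1, P'_{j0} = 0, P'_{i1} = 0, P'_{j1} = 1`). [cite: BurgisserIkenmeyer2017, §7 (Appendix) Prop. 7.5] -/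
theorem exists_conj_two_cols_reduced_of_minor {g P : Matrix (Fin 3) (Fin 3) ℂ} (hP : P.det ≠ 0)
    {l μ : ℂ} (hgP : g * P = P * !![l, 0, 0; 0, l, 0; 0, 0, μ]) (i j : Fin 3)
    (hΔ : P i 0 * P j 1 - P i 1 * P j 0 ≠ 0) :
    ∃ P' : Matrix (Fin 3) (Fin 3) ℂ, P'.det ≠ 0 ∧ g * P' = P' * !![l, 0, 0; 0, l, 0; 0, 0, μ] ∧
      P' i 0 = 1 ∧ P' j 0 = 0 ∧ P' i 1 = 0 ∧ P' j 1 = 1 := by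
  set Δ : ℂ := P i 0 * P j 1 - P i 1 * P j 0 with hΔdef
  set C : Matrix (Fin 3) (Fin 3) ℂ :=
    !![P j 1 / Δ, -P i 1 / Δ, 0; -P j 0 / Δ, P i 0 / Δ, 0; 0, 0, 1] with hC
  have hCdet : C.det = Δ⁻¹ := by
    rw [Matrix.det_fin_three]
    simp only [hC, Matrix.of_apply, Matrix.cons_val', Matrix.cons_val_zero, Matrix.cons_val_one,
      Matrix.empty_val', Matrix.cons_val_fin_one, Matrix.cons_val_two, Matrix.tail_cons,
      Matrix.head_cons, Matrix.head_fin_const]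
    field_simp
    ring
  refine ⟨P * C, ?_, ?_, ?_, ?_, ?_, ?_⟩
  · rw [Matrix.det_mul, hCdet]; exact mul_ne_zero hP (inv_ne_zero hΔ)
  · have hcomm : (!![l, 0, 0; 0, l, 0; 0, 0, μ] : Matrix (Fin 3) (Fin 3) ℂ) * C =
        C * !![l, 0, 0; 0, l, 0; 0, 0, μ] := by
      ext a b; fin_cases a <;> fin_cases b <;> simp [hC, Matrix.mul_apply, Fin.sum_univ_three, mul_comm]
    rw [← Matrix.mul_assoc, hgP, Matrix.mul_assoc, hcomm, Matrix.mul_assoc]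
  · simp only [Matrix.mul_apply, Fin.sum_univ_three, hC, Matrix.of_apply, Matrix.cons_val',
      Matrix.cons_val_zero, Matrix.cons_val_one, Matrix.empty_val', Matrix.cons_val_fin_one,
      Matrix.cons_val_two, Matrix.tail_cons, Matrix.head_fin_const]
    field_simp
    ring
  · simp only [Matrix.mul_apply, Fin.sum_univ_three, hC, Matrix.of_apply, Matrix.cons_val',
      Matrix.cons_val_zero, Matrix.cons_val_one, Matrix.empty_val', Matrix.cons_val_fin_one,
      Matrix.cons_val_two, Matrix.tail_cons, Matrix.head_fin_const]
    field_simp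
    ring
  · simp only [Matrix.mul_apply, Fin.sum_univ_three, hC, Matrix.of_apply, Matrix.cons_val',
      Matrix.cons_val_zero, Matrix.cons_val_one, Matrix.empty_val', Matrix.cons_val_fin_one,
      Matrix.cons_val_two, Matrix.tail_cons, Matrix.head_fin_const]
    field_simp
    ring
  · simp only [Matrix.mul_apply, Fin.sum_univ_three, hC, Matrix.of_apply, Matrix.cons_val',
      Matrix.cons_val_zero, Matrix.cons_val_one, Matrix.empty_val', Matrix.cons_val_fin_one,
      Matrix.cons_val_two, Matrix.tail_cons, Matrix.head_fin_const]
    field_simp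
    ring

/-- **Chart for `diag(λ, λ, μ)`**: `g P' = P' diag(λ, λ, μ)` with the first two columns of `P'`
reduced in the pivot rows complementary to some row `k` (rows `i = (1,0,0)_k`, `j = (2,2,1)_k`).
[cite: BurgisserIkenmeyer2017, §7 (Appendix) Prop. 7.5] -/
theorem exists_conj_two_cols_reduced {g P : Matrix (Fin 3) (Fin 3) ℂ} (hP : P.det ≠ 0) {l μ : ℂ}
    (hgP : g * P = P * !![l, 0, 0; 0, l, 0; 0, 0, μ]) :
    ∃ (P' : Matrix (Fin 3) (Fin 3) ℂ) (k : Fin 3), P'.det ≠ 0 ∧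
      g * P' = P' * !![l, 0, 0; 0, l, 0; 0, 0, μ] ∧
      P' ((![1, 0, 0] : Fin 3 → Fin 3) k) 0 = 1 ∧ P' ((![2, 2, 1] : Fin 3 → Fin 3) k) 0 = 0 ∧
      P' ((![1, 0, 0] : Fin 3 → Fin 3) k) 1 = 0 ∧ P' ((![2, 2, 1] : Fin 3 → Fin 3) k) 1 = 1 := by
  by_cases h12 : P 1 0 * P 2 1 - P 1 1 * P 2 0 = 0
  · by_cases h02 : P 0 0 * P 2 1 - P 0 1 * P 2 0 = 0
    · have h01 : P 0 0 * P 1 1 - P 0 1 * P 1 0 ≠ 0 := fun h01 =>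
        hP (det_eq_zero_of_minors_eq_zero h12 h02 h01)
      obtain ⟨P', h1, h2, h3, h4, h5, h6⟩ := exists_conj_two_cols_reduced_of_minor hP hgP 0 1 h01
      exact ⟨P', 2, h1, h2, by simpa using h3, by simpa using h4, by simpa using h5, by simpa using h6⟩
    · obtain ⟨P', h1, h2, h3, h4, h5, h6⟩ := exists_conj_two_cols_reduced_of_minor hP hgP 0 2 h02
      exact ⟨P', 1, h1, h2, by simpa using h3, by simpa using h4, by simpa using h5, by simpa using h6⟩
  · obtain ⟨P', h1, h2, h3, h4, h5, h6⟩ := exists_conj_two_cols_reduced_of_minor hP hgP 1 2 h12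
    exact ⟨P', 0, h1, h2, by simpa using h3, by simpa using h4, by simpa using h5, by simpa using h6⟩

end Charts

/-! ### §2 The four covering families -/

section Covers

/-- A linear substitution of a ternary monomial: `P · (c x^e) = c ∏_i (∑_j P_{ji} x_j)^{e_i}`.
[cite: BurgisserIkenmeyer2017, §7 (Appendix) Prop. 7.5] -/
theorem linSubst_monomial_fin_three (P : Matrix (Fin 3) (Fin 3) ℂ) (e : Fin 3 →₀ ℕ) (c : ℂ) :
    linSubst (Fin 3) ℂ P (monomial e c) =
      C c * (C (P 0 0) * X 0 + C (P 1 0) * X 1 + C (P 2 0) * X 2) ^ e 0 * (C (P 0 1) * X 0 + C (P 1 1) * X 1 + C (P 2 1) * X 2) ^ e 1 * (C (P 0 2) * X 0 + C (P 1 2) * X 1 + C (P 2 2) * X 2) ^ e 2 := by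
  rw [show linSubst (Fin 3) ℂ P = aeval (fun i => ∑ j, P j i • X j) from rfl, aeval_monomial,
    algebraMap_eq, Finsupp.prod_fintype _ _ (fun i => pow_zero _), Fin.prod_univ_three]
  simp only [Fin.sum_univ_three, smul_eq_C_mul]
  ring

/-- `dim Sym⁴ ℂ³ = 15`. [cite: BurgisserIkenmeyer2017, §7 (Appendix) Prop. 7.5] -/
theorem card_degIdx_fin_three_four : Fintype.card (DegIdx (Fin 3) 4) = 15 := by
  rw [Fintype.card_coe, degMonomials, Finset.card_finsuppAntidiag_nat_eq_choose, Finset.card_univ,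
    Fintype.card_fin]
  decide

/-- **Cover (U1).** If `f = P · f̃` with `f̃ ∈ ℂ[x₀, x₁]₄` (no monomial of the quartic `f̃` involves
`x₂`), then `f = ∑_{a ≤ 4} c_a ℓ₀^a ℓ₁^{4-a}` for the two linear forms `ℓ₀, ℓ₁` given by the first two
columns of `P`: an `11`-parameter family. [cite: BurgisserIkenmeyer2017, §7 (Appendix) Prop. 7.5] -/
theorem cover_jordan_two {f g : MvPolynomial (Fin 3) ℂ} (hg : g.IsHomogeneous 4)
    (P : Matrix (Fin 3) (Fin 3) ℂ) (hfg : f = linSubst (Fin 3) ℂ P g)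
    (hsupp : ∀ e ∈ g.support, e 2 = 0) :
    ∃ (c : Fin 5 → ℂ) (q₀ q₁ : Fin 3 → ℂ), f = ∑ a : Fin 5,
      C (c a) * (C (q₀ 0) * X 0 + C (q₀ 1) * X 1 + C (q₀ 2) * X 2) ^ (a : ℕ) * (C (q₁ 0) * X 0 + C (q₁ 1) * X 1 + C (q₁ 2) * X 2) ^ (4 - (a : ℕ)) := by
  classical
  -- `g = ∑_a c_a x₀^a x₁^{4-a}`
  have hexp := eq_sum_monomial_fin_three hg
  have hg' : g = ∑ a ∈ Finset.range 5,
      monomial (Finsupp.single 0 a + Finsupp.single 1 (4 - a) + Finsupp.single 2 (4 - a - (4 - a)))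
        (coeff (Finsupp.single 0 a + Finsupp.single 1 (4 - a) + Finsupp.single 2 (4 - a - (4 - a))) g) := by
    conv_lhs => rw [hexp]
    refine Finset.sum_congr rfl fun a ha => ?_
    rw [Finset.mem_range] at ha
    rw [Finset.sum_eq_single (4 - a)]
    · intro b hb hba
      rw [Finset.mem_range] at hb
      have hc : coeff (Finsupp.single 0 a + Finsupp.single 1 b + Finsupp.single 2 (4 - a - b)) g = 0 := by
        by_contra hne
        have h2 := hsupp _ (mem_support_iff.mpr hne)
        simp at h2
        omega
      rw [hc, monomial_zero]
    · intro h
      exfalso; apply h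
      rw [Finset.mem_range]; omega
  refine ⟨fun a => coeff (Finsupp.single 0 (a : ℕ) + Finsupp.single 1 (4 - (a : ℕ)) +
      Finsupp.single 2 (4 - (a : ℕ) - (4 - (a : ℕ)))) g, fun j => P j 0, fun j => P j 1, ?_⟩
  conv_lhs => rw [hfg, hg', map_sum, Finset.sum_range]
  refine Finset.sum_congr rfl fun a _ => ?_
  rw [linSubst_monomial_fin_three]
  have h0 : ((Finsupp.single (0 : Fin 3) (a : ℕ) + Finsupp.single 1 (4 - (a : ℕ)) +
      Finsupp.single 2 (4 - (a : ℕ) - (4 - (a : ℕ))) : Fin 3 →₀ ℕ) : Fin 3 → ℕ) 0 = a := by simp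
  have h1 : ((Finsupp.single (0 : Fin 3) (a : ℕ) + Finsupp.single 1 (4 - (a : ℕ)) +
      Finsupp.single 2 (4 - (a : ℕ) - (4 - (a : ℕ))) : Fin 3 →₀ ℕ) : Fin 3 → ℕ) 1 = 4 - (a : ℕ) := by simp
  have h2 : ((Finsupp.single (0 : Fin 3) (a : ℕ) + Finsupp.single 1 (4 - (a : ℕ)) +
      Finsupp.single 2 (4 - (a : ℕ) - (4 - (a : ℕ))) : Fin 3 →₀ ℕ) : Fin 3 → ℕ) 2 = 0 := by simp
  rw [h0, h1, h2, pow_zero, mul_one]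

/-- **Cover (U2).** If `f = P · f̃` with `f̃ = c₁ x₀⁴ + c₂ x₀² q + c₃ q²`, then `f` is the same
expression in the three linear forms given by the columns of `P`: a `12`-parameter family.
[cite: BurgisserIkenmeyer2017, §7 (Appendix) Prop. 7.5] -/
theorem cover_jordan_three {f g : MvPolynomial (Fin 3) ℂ} (P : Matrix (Fin 3) (Fin 3) ℂ)
    (hfg : f = linSubst (Fin 3) ℂ P g) {c₁ c₂ c₃ : ℂ}
    (hg : g = C c₁ * X 0 ^ 4 + C c₂ * (X 0 ^ 2 * (X 1 ^ 2 - 2 * X 0 * X 2 - X 0 * X 1)) +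
      C c₃ * (X 1 ^ 2 - 2 * X 0 * X 2 - X 0 * X 1) ^ 2) :
    ∃ (c : Fin 3 → ℂ) (q₀ q₁ q₂ : Fin 3 → ℂ), f =
      C (c 0) * (C (q₀ 0) * X 0 + C (q₀ 1) * X 1 + C (q₀ 2) * X 2) ^ 4 +
      C (c 1) * ((C (q₀ 0) * X 0 + C (q₀ 1) * X 1 + C (q₀ 2) * X 2) ^ 2 * ((C (q₁ 0) * X 0 + C (q₁ 1) * X 1 + C (q₁ 2) * X 2) ^ 2 - 2 * (C (q₀ 0) * X 0 + C (q₀ 1) * X 1 + C (q₀ 2) * X 2) * (C (q₂ 0) * X 0 + C (q₂ 1) * X 1 + C (q₂ 2) * X 2) - (C (q₀ 0) * X 0 + C (q₀ 1) * X 1 + C (q₀ 2) * X 2) * (C (q₁ 0) * X 0 + C (q₁ 1) * X 1 + C (q₁ 2) * X 2))) +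
      C (c 2) * ((C (q₁ 0) * X 0 + C (q₁ 1) * X 1 + C (q₁ 2) * X 2) ^ 2 - 2 * (C (q₀ 0) * X 0 + C (q₀ 1) * X 1 + C (q₀ 2) * X 2) * (C (q₂ 0) * X 0 + C (q₂ 1) * X 1 + C (q₂ 2) * X 2) - (C (q₀ 0) * X 0 + C (q₀ 1) * X 1 + C (q₀ 2) * X 2) * (C (q₁ 0) * X 0 + C (q₁ 1) * X 1 + C (q₁ 2) * X 2)) ^ 2 := by
  refine ⟨![c₁, c₂, c₃], fun j => P j 0, fun j => P j 1, fun j => P j 2, ?_⟩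
  rw [hfg, hg]
  simp only [map_add, map_sub, map_mul, map_pow, linSubst_C, linSubst_X, Fin.sum_univ_three,
    smul_eq_C_mul, map_ofNat, Matrix.cons_val_zero, Matrix.cons_val_one, Matrix.cons_val_two,
    Matrix.tail_cons, Matrix.head_cons]

/-- A form with at most `n ≤ 15` monomials is a sum over `n` degree-`4` exponents.
[cite: BurgisserIkenmeyer2017, §7 (Appendix) Prop. 7.5] -/
theorem exists_eq_sum_monomial_of_card_le {g : MvPolynomial (Fin 3) ℂ} (hg : g.IsHomogeneous 4)
    {n : ℕ} (hn : g.support.card ≤ n) (hn15 : n ≤ 15) :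
    ∃ (ι : Fin n → DegIdx (Fin 3) 4) (c : Fin n → ℂ), g = ∑ k : Fin n, monomial (ι k).1 (c k) := by
  classical
  have hsub : g.support ⊆ degMonomials (Fin 3) 4 := fun e he =>
    mem_degMonomials_iff.mpr (by
      rw [Finsupp.degree_eq_weight_one]
      exact hg (mem_support_iff.mp he))
  have h15 : n ≤ (degMonomials (Fin 3) 4).card := by
    have := card_degIdx_fin_three_four
    rw [Fintype.card_coe] at this
    omega
  obtain ⟨S, hgS, hSdeg, hScard⟩ := Finset.exists_subsuperset_card_eq hsub hn h15
  let e : Fin n ≃ ↥S := (S.equivFin.trans (finCongr hScard)).symm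
  refine ⟨fun k => ⟨(e k).1, hSdeg (e k).2⟩, fun k => coeff (e k).1 g, ?_⟩
  have h1 : g = ∑ s ∈ S, monomial s (coeff s g) := by
    conv_lhs => rw [g.as_sum]
    exact Finset.sum_subset hgS fun s _ hs => by rw [notMem_support_iff.mp hs, monomial_zero]
  calc g = ∑ s ∈ S, monomial s (coeff s g) := h1
    _ = ∑ s : ↥S, monomial s.1 (coeff s.1 g) := (Finset.sum_coe_sort S _).symm
    _ = ∑ k : Fin n, monomial (e k).1 (coeff (e k).1 g) :=
        (Equiv.sum_comp e (fun s : ↥S => monomial s.1 (coeff s.1 g))).symm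
    _ = _ := rfl

/-- **Cover (D3).** If `f = P · f̃` with `f̃` a quartic with at most `6` monomials and
`P_{p0} = 1`, then `f = ∑_{k<6} c_k ℓ₀^{e_k,0} ℓ₁^{e_k,1} ℓ₂^{e_k,2}` with
`ℓ₀ = x_p + r₀ x_{p'} + r₁ x_{p''}`: a `6 + 2 + 6 = 14`-parameter family for each `p` and each
choice of exponents. [cite: BurgisserIkenmeyer2017, §7 (Appendix) Prop. 7.5] -/
theorem cover_diagonal_three {f g : MvPolynomial (Fin 3) ℂ} (hg : g.IsHomogeneous 4)
    (P : Matrix (Fin 3) (Fin 3) ℂ) (hfg : f = linSubst (Fin 3) ℂ P g) (hcard : g.support.card ≤ 6)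
    (p : Fin 3) (hp : P p 0 = 1) :
    ∃ (ι : Fin 6 → DegIdx (Fin 3) 4) (c : Fin 6 → ℂ) (r : Fin 2 → ℂ) (q₁ q₂ : Fin 3 → ℂ),
      f = ∑ k : Fin 6, C (c k) *
        (X p + C (r 0) * X ((![1, 0, 0] : Fin 3 → Fin 3) p) +
          C (r 1) * X ((![2, 2, 1] : Fin 3 → Fin 3) p)) ^ (ι k).1 0 *
        (C (q₁ 0) * X 0 + C (q₁ 1) * X 1 + C (q₁ 2) * X 2) ^ (ι k).1 1 * (C (q₂ 0) * X 0 + C (q₂ 1) * X 1 + C (q₂ 2) * X 2) ^ (ι k).1 2 := by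
  obtain ⟨ι, c, hgι⟩ := exists_eq_sum_monomial_of_card_le hg hcard (by norm_num)
  refine ⟨ι, c, ![P ((![1, 0, 0] : Fin 3 → Fin 3) p) 0, P ((![2, 2, 1] : Fin 3 → Fin 3) p) 0],
    fun j => P j 1, fun j => P j 2, ?_⟩
  have hcol : (C (P 0 0) * X 0 + C (P 1 0) * X 1 + C (P 2 0) * X 2) =
      X p + C (P ((![1, 0, 0] : Fin 3 → Fin 3) p) 0) * X ((![1, 0, 0] : Fin 3 → Fin 3) p) +
        C (P ((![2, 2, 1] : Fin 3 → Fin 3) p) 0) * X ((![2, 2, 1] : Fin 3 → Fin 3) p) := by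
    fin_cases p
    · simp at hp ⊢
      simp [hp]
    · simp at hp ⊢
      simp [hp]
      ring
    · simp at hp ⊢
      simp [hp]
      ring
  rw [hfg, hgι, map_sum]
  refine Finset.sum_congr rfl fun k _ => ?_
  rw [linSubst_monomial_fin_three, hcol]
  simp

/-- **Cover (D2).** If `f = P · f̃` with `f̃` a quartic with at most `9` monomials and the first
two columns of `P` reduced in the pivot rows complementary to `k`, then `f` lies in a
`9 + 2 + 3 = 14`-parameter family for each `k` and each choice of exponents.
[cite: BurgisserIkenmeyer2017, §7 (Appendix) Prop. 7.5] -/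
theorem cover_diagonal_pair {f g : MvPolynomial (Fin 3) ℂ} (hg : g.IsHomogeneous 4)
    (P : Matrix (Fin 3) (Fin 3) ℂ) (hfg : f = linSubst (Fin 3) ℂ P g) (hcard : g.support.card ≤ 9)
    (k : Fin 3) (h1 : P ((![1, 0, 0] : Fin 3 → Fin 3) k) 0 = 1)
    (h2 : P ((![2, 2, 1] : Fin 3 → Fin 3) k) 0 = 0) (h3 : P ((![1, 0, 0] : Fin 3 → Fin 3) k) 1 = 0)
    (h4 : P ((![2, 2, 1] : Fin 3 → Fin 3) k) 1 = 1) :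
    ∃ (ι : Fin 9 → DegIdx (Fin 3) 4) (c : Fin 9 → ℂ) (r : Fin 2 → ℂ) (q₂ : Fin 3 → ℂ),
      f = ∑ n : Fin 9, C (c n) *
        (X ((![1, 0, 0] : Fin 3 → Fin 3) k) + C (r 0) * X k) ^ (ι n).1 0 *
        (X ((![2, 2, 1] : Fin 3 → Fin 3) k) + C (r 1) * X k) ^ (ι n).1 1 *
        (C (q₂ 0) * X 0 + C (q₂ 1) * X 1 + C (q₂ 2) * X 2) ^ (ι n).1 2 := by
  obtain ⟨ι, c, hgι⟩ := exists_eq_sum_monomial_of_card_le hg hcard (by norm_num)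
  refine ⟨ι, c, ![P k 0, P k 1], fun j => P j 2, ?_⟩
  have hcol0 : (C (P 0 0) * X 0 + C (P 1 0) * X 1 + C (P 2 0) * X 2) =
      X ((![1, 0, 0] : Fin 3 → Fin 3) k) + C (P k 0) * X k := by
    fin_cases k
    · simp at h1 h2 ⊢
      simp [h1, h2]
      ring
    · simp at h1 h2 ⊢
      simp [h1, h2]
    · simp at h1 h2 ⊢
      simp [h1, h2]
  have hcol1 : (C (P 0 1) * X 0 + C (P 1 1) * X 1 + C (P 2 1) * X 2) =
      X ((![2, 2, 1] : Fin 3 → Fin 3) k) + C (P k 1) * X k := by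
    fin_cases k
    · simp at h3 h4 ⊢
      simp [h3, h4]
      ring
    · simp at h3 h4 ⊢
      simp [h3, h4]
      ring
    · simp at h3 h4 ⊢
      simp [h3, h4]
  rw [hfg, hgι, map_sum]
  refine Finset.sum_congr rfl fun n _ => ?_
  rw [linSubst_monomial_fin_three, hcol0, hcol1]
  simp

end Covers

/-! ### §3 The theorem -/

section Main

/-- **A generic ternary quartic has trivial stabilizer** — Bürgisser–Ikenmeyer 2017 Thm. 2.3 /
App. Prop. 7.5 (2) at `(D, m) = (4, 3)` AS CORRECTED (erratum A21: the printed "`stab(w) ≃ C₂`,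
`a'(4,3) = 2`" is false; the generic stabilizer is `μ₄ · I`, `a(4,3) = 4`, `a'(4,3) = 1`), and
Poonen 2005 Thm. 3 at `(n, d) = (1, 4)` over `ℂ` in the language of BI 2017 §2.1: for a
Zariski-generic `f ∈ Sym⁴ ℂ³`, `stab(f) = {ζ I : ζ⁴ = 1}`. The genericity polynomial is the
product of the nonzero polynomials (transcendence-degree argument
`exists_ne_zero_aeval_formCoeff_map_eq_zero`) vanishing on the four covering families (D3),
(D2), (U1), (U2), each with fewer than `15 = dim Sym⁴ ℂ³` parameters.
[cite: BurgisserIkenmeyer2017, Thm. 2.3] -/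
theorem isZariskiGeneric_hasTrivialStabilizer_ternaryQuartic :
    IsZariskiGeneric 4 (HasTrivialStabilizer 4 : MvPolynomial (Fin 3) ℂ → Prop) := by
  classical
  -- (U1) family: 11 parameters
  have hU1 : ∃ Q : MvPolynomial (DegIdx (Fin 3) 4) ℂ, Q ≠ 0 ∧
      ∀ (c : Fin 5 → ℂ) (q₀ q₁ : Fin 3 → ℂ), aeval (formCoeff 4 (∑ a : Fin 5, C (c a) * (C (q₀ 0) * X 0 + C (q₀ 1) * X 1 + C (q₀ 2) * X 2) ^ (a : ℕ) * (C (q₁ 0) * X 0 + C (q₁ 1) * X 1 + C (q₁ 2) * X 2) ^ (4 - (a : ℕ)))) Q = 0 := by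
    have hK : 5 + (3 + 3) < Fintype.card (DegIdx (Fin 3) 4) := by
      rw [card_degIdx_fin_three_four]; norm_num
    obtain ⟨Q, hQ0, hQ⟩ := exists_ne_zero_aeval_formCoeff_map_eq_zero hK
      (∑ a : Fin 5, C (X (Fin.castAdd (3 + 3) a) : MvPolynomial (Fin (5 + (3 + 3))) ℂ) * (C ((X (Fin.natAdd 5 (Fin.castAdd 3 0)) : MvPolynomial (Fin (5 + (3 + 3))) ℂ)) * X 0 + C ((X (Fin.natAdd 5 (Fin.castAdd 3 1)) : MvPolynomial (Fin (5 + (3 + 3))) ℂ)) * X 1 + C ((X (Fin.natAdd 5 (Fin.castAdd 3 2)) : MvPolynomial (Fin (5 + (3 + 3))) ℂ)) * X 2) ^ (a : ℕ) * (C ((X (Fin.natAdd 5 (Fin.natAdd 3 0)) : MvPolynomial (Fin (5 + (3 + 3))) ℂ)) * X 0 + C ((X (Fin.natAdd 5 (Fin.natAdd 3 1)) : MvPolynomial (Fin (5 + (3 + 3))) ℂ)) * X 1 + C ((X (Fin.natAdd 5 (Fin.natAdd 3 2)) : MvPolynomial (Fin (5 + (3 + 3))) ℂ)) * X 2) ^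 (4 - (a : ℕ)))
    refine ⟨Q, hQ0, fun c q₀ q₁ => ?_⟩
    have h := hQ (Fin.append c (Fin.append q₀ q₁))
    simp only [map_sum, map_mul, map_pow, map_add, map_C, map_X, eval_X, Fin.append_left,
        Fin.append_right] at h
    exact h
  -- (U2) family: 12 parameters
  have hU2 : ∃ Q : MvPolynomial (DegIdx (Fin 3) 4) ℂ, Q ≠ 0 ∧
      ∀ (c q₀ q₁ q₂ : Fin 3 → ℂ), aeval (formCoeff 4 (C (c 0) * (C (q₀ 0) * X 0 + C (q₀ 1) * X 1 + C (q₀ 2) * X 2) ^ 4 +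
      C (c 1) * ((C (q₀ 0) * X 0 + C (q₀ 1) * X 1 + C (q₀ 2) * X 2) ^ 2 * ((C (q₁ 0) * X 0 + C (q₁ 1) * X 1 + C (q₁ 2) * X 2) ^ 2 - 2 * (C (q₀ 0) * X 0 + C (q₀ 1) * X 1 + C (q₀ 2) * X 2) * (C (q₂ 0) * X 0 + C (q₂ 1) * X 1 + C (q₂ 2) * X 2) - (C (q₀ 0) * X 0 + C (q₀ 1) * X 1 + C (q₀ 2) * X 2) * (C (q₁ 0) * X 0 + C (q₁ 1) * X 1 + C (q₁ 2) * X 2))) +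
      C (c 2) * ((C (q₁ 0) * X 0 + C (q₁ 1) * X 1 + C (q₁ 2) * X 2) ^ 2 - 2 * (C (q₀ 0) * X 0 + C (q₀ 1) * X 1 + C (q₀ 2) * X 2) * (C (q₂ 0) * X 0 + C (q₂ 1) * X 1 + C (q₂ 2) * X 2) - (C (q₀ 0) * X 0 + C (q₀ 1) * X 1 + C (q₀ 2) * X 2) * (C (q₁ 0) * X 0 + C (q₁ 1) * X 1 + C (q₁ 2) * X 2)) ^ 2)) Q = 0 := by
    have hK : 3 + (3 + (3 + 3)) < Fintype.card (DegIdx (Fin 3) 4) := by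
      rw [card_degIdx_fin_three_four]; norm_num
    obtain ⟨Q, hQ0, hQ⟩ := exists_ne_zero_aeval_formCoeff_map_eq_zero hK
      (C ((X (Fin.castAdd (3 + (3 + 3)) 0) : MvPolynomial (Fin (3 + (3 + (3 + 3)))) ℂ)) * (C ((X (Fin.natAdd 3 (Fin.castAdd (3 + 3) 0)) : MvPolynomial (Fin (3 + (3 + (3 + 3)))) ℂ)) * X 0 + C ((X (Fin.natAdd 3 (Fin.castAdd (3 + 3) 1)) : MvPolynomial (Fin (3 + (3 + (3 + 3)))) ℂ)) * X 1 + C ((X (Fin.natAdd 3 (Fin.castAdd (3 + 3) 2)) : MvPolynomial (Fin (3 + (3 + (3 + 3)))) ℂ)) * X 2) ^ 4 +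
      C ((X (Fin.castAdd (3 + (3 + 3)) 1) : MvPolynomial (Fin (3 + (3 + (3 + 3)))) ℂ)) * ((C ((X (Fin.natAdd 3 (Fin.castAdd (3 + 3) 0)) : MvPolynomial (Fin (3 + (3 + (3 + 3)))) ℂ)) * X 0 + C ((X (Fin.natAdd 3 (Fin.castAdd (3 + 3) 1)) : MvPolynomial (Fin (3 + (3 + (3 + 3)))) ℂ)) * X 1 + C ((X (Fin.natAdd 3 (Fin.castAdd (3 + 3) 2)) : MvPolynomial (Fin (3 + (3 + (3 + 3)))) ℂ)) * X 2) ^ 2 * ((C ((X (Fin.natAdd 3 (Fin.natAdd 3 (Fin.castAdd 3 0))) : MvPolynomial (Fin (3 + (3 + (3 + 3)))) ℂ)) * X 0 + C ((X (Fin.natAdd 3 (Fin.natAdd 3 (Fin.castAdd 3 1))) : MvPolynomial (Fin (3 + (3 + (3 + 3)))) ℂ)) * X 1 + C ((X (Fin.natAdd 3 (Fin.natAdd 3 (Fin.castAdd 3 2))) : MvPolynomial (Fin (3 + (3 + (3 + 3)))) ℂ)) * X 2) ^ 2 - 2 * (C ((X (Fin.natAdd 3 (Fin.castAdd (3 + 3)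 0)) : MvPolynomial (Fin (3 + (3 + (3 + 3)))) ℂ)) * X 0 + C ((X (Fin.natAdd 3 (Fin.castAdd (3 + 3) 1)) : MvPolynomial (Fin (3 + (3 + (3 + 3)))) ℂ)) * X 1 + C ((X (Fin.natAdd 3 (Fin.castAdd (3 + 3) 2)) : MvPolynomial (Fin (3 + (3 + (3 + 3)))) ℂ)) * X 2) * (C ((X (Fin.natAdd 3 (Fin.natAdd 3 (Fin.natAdd 3 0))) : MvPolynomial (Fin (3 + (3 + (3 + 3)))) ℂ)) * X 0 + C ((X (Fin.natAdd 3 (Fin.natAdd 3 (Fin.natAdd 3 1))) : MvPolynomial (Fin (3 + (3 + (3 + 3)))) ℂ)) * X 1 + C ((X (Fin.natAdd 3 (Fin.natAdd 3 (Fin.natAdd 3 2))) : MvPolynomial (Fin (3 + (3 + (3 + 3)))) ℂ)) * X 2) - (C ((X (Fin.natAdd 3 (Fin.castAdd (3 + 3) 0)) : MvPolynomial (Fin (3 + (3 + (3 + 3)))) ℂ)) * X 0 + C ((X (Fin.natAdd 3 (Fin.castAdd (3 + 3) 1)) : MvPolynomial (Fin (3 + (3 + (3 + 3)))) ℂ))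 * X 1 + C ((X (Fin.natAdd 3 (Fin.castAdd (3 + 3) 2)) : MvPolynomial (Fin (3 + (3 + (3 + 3)))) ℂ)) * X 2) * (C ((X (Fin.natAdd 3 (Fin.natAdd 3 (Fin.castAdd 3 0))) : MvPolynomial (Fin (3 + (3 + (3 + 3)))) ℂ)) * X 0 + C ((X (Fin.natAdd 3 (Fin.natAdd 3 (Fin.castAdd 3 1))) : MvPolynomial (Fin (3 + (3 + (3 + 3)))) ℂ)) * X 1 + C ((X (Fin.natAdd 3 (Fin.natAdd 3 (Fin.castAdd 3 2))) : MvPolynomial (Fin (3 + (3 + (3 + 3)))) ℂ)) * X 2))) +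
      C ((X (Fin.castAdd (3 + (3 + 3)) 2) : MvPolynomial (Fin (3 + (3 + (3 + 3)))) ℂ)) * ((C ((X (Fin.natAdd 3 (Fin.natAdd 3 (Fin.castAdd 3 0))) : MvPolynomial (Fin (3 + (3 + (3 + 3)))) ℂ)) * X 0 + C ((X (Fin.natAdd 3 (Fin.natAdd 3 (Fin.castAdd 3 1))) : MvPolynomial (Fin (3 + (3 + (3 + 3)))) ℂ)) * X 1 + C ((X (Fin.natAdd 3 (Fin.natAdd 3 (Fin.castAdd 3 2))) : MvPolynomial (Fin (3 + (3 + (3 + 3)))) ℂ)) * X 2) ^ 2 - 2 * (C ((X (Fin.natAdd 3 (Fin.castAdd (3 + 3) 0)) : MvPolynomial (Fin (3 + (3 + (3 + 3)))) ℂ)) * X 0 + C ((X (Fin.natAdd 3 (Fin.castAdd (3 + 3) 1)) : MvPolynomial (Fin (3 + (3 + (3 + 3)))) ℂ)) * X 1 + C ((X (Fin.natAdd 3 (Fin.castAdd (3 + 3) 2)) : MvPolynomial (Fin (3 + (3 + (3 + 3)))) ℂ)) * X 2) * (C ((X (Fin.natAdd 3 (Fin.natAdd 3 (Fin.natAdd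 3 0))) : MvPolynomial (Fin (3 + (3 + (3 + 3)))) ℂ)) * X 0 + C ((X (Fin.natAdd 3 (Fin.natAdd 3 (Fin.natAdd 3 1))) : MvPolynomial (Fin (3 + (3 + (3 + 3)))) ℂ)) * X 1 + C ((X (Fin.natAdd 3 (Fin.natAdd 3 (Fin.natAdd 3 2))) : MvPolynomial (Fin (3 + (3 + (3 + 3)))) ℂ)) * X 2) - (C ((X (Fin.natAdd 3 (Fin.castAdd (3 + 3) 0)) : MvPolynomial (Fin (3 + (3 + (3 + 3)))) ℂ)) * X 0 + C ((X (Fin.natAdd 3 (Fin.castAdd (3 + 3) 1)) : MvPolynomial (Fin (3 + (3 + (3 + 3)))) ℂ)) * X 1 + C ((X (Fin.natAdd 3 (Fin.castAdd (3 + 3) 2)) : MvPolynomial (Fin (3 + (3 + (3 + 3)))) ℂ)) * X 2) * (C ((X (Fin.natAdd 3 (Fin.natAdd 3 (Fin.castAdd 3 0))) : MvPolynomial (Fin (3 + (3 + (3 + 3)))) ℂ)) * X 0 + C ((X (Fin.natAdd 3 (Fin.natAdd 3 (Fin.castAdd 3 1))) : MvPolynomial (Fin (3 + (3 + (3 + 3))))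 ℂ)) * X 1 + C ((X (Fin.natAdd 3 (Fin.natAdd 3 (Fin.castAdd 3 2))) : MvPolynomial (Fin (3 + (3 + (3 + 3)))) ℂ)) * X 2)) ^ 2)
    refine ⟨Q, hQ0, fun c q₀ q₁ q₂ => ?_⟩
    have h := hQ (Fin.append c (Fin.append q₀ (Fin.append q₁ q₂)))
    simp only [map_mul, map_pow, map_add, map_sub, map_C, map_X, eval_X, Fin.append_left,
        Fin.append_right, map_ofNat] at h
    exact h
  -- (D3) families: 14 parameters each
  have hD3 : ∀ (p : Fin 3) (ι : Fin 6 → DegIdx (Fin 3) 4),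
      ∃ Q : MvPolynomial (DegIdx (Fin 3) 4) ℂ, Q ≠ 0 ∧
      ∀ (c : Fin 6 → ℂ) (r : Fin 2 → ℂ) (q₁ q₂ : Fin 3 → ℂ), aeval (formCoeff 4 (∑ k : Fin 6, C (c k) *
        (X p + C (r 0) * X ((![1, 0, 0] : Fin 3 → Fin 3) p) +
          C (r 1) * X ((![2, 2, 1] : Fin 3 → Fin 3) p)) ^ (ι k).1 0 *
        (C (q₁ 0) * X 0 + C (q₁ 1) * X 1 + C (q₁ 2) * X 2) ^ (ι k).1 1 * (C (q₂ 0) * X 0 + C (q₂ 1) * X 1 + C (q₂ 2) * X 2) ^ (ι k).1 2)) Q = 0 := by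
    intro p ι
    have hK : 6 + (2 + (3 + 3)) < Fintype.card (DegIdx (Fin 3) 4) := by
      rw [card_degIdx_fin_three_four]; norm_num
    obtain ⟨Q, hQ0, hQ⟩ := exists_ne_zero_aeval_formCoeff_map_eq_zero hK
      (∑ k : Fin 6, C (X (Fin.castAdd (2 + (3 + 3)) k) : MvPolynomial (Fin (6 + (2 + (3 + 3)))) ℂ) *
        (X p + C (X (Fin.natAdd 6 (Fin.castAdd (3 + 3) 0)) : MvPolynomial (Fin (6 + (2 + (3 + 3)))) ℂ) * X ((![1, 0, 0] : Fin 3 → Fin 3) p) +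
          C (X (Fin.natAdd 6 (Fin.castAdd (3 + 3) 1)) : MvPolynomial (Fin (6 + (2 + (3 + 3)))) ℂ) * X ((![2, 2, 1] : Fin 3 → Fin 3) p)) ^ (ι k).1 0 *
        (C ((X (Fin.natAdd 6 (Fin.natAdd 2 (Fin.castAdd 3 0))) : MvPolynomial (Fin (6 + (2 + (3 + 3)))) ℂ)) * X 0 + C ((X (Fin.natAdd 6 (Fin.natAdd 2 (Fin.castAdd 3 1))) : MvPolynomial (Fin (6 + (2 + (3 + 3)))) ℂ)) * X 1 + C ((X (Fin.natAdd 6 (Fin.natAdd 2 (Fin.castAdd 3 2))) : MvPolynomial (Fin (6 + (2 + (3 + 3)))) ℂ)) * X 2) ^ (ι k).1 1 * (C ((X (Fin.natAdd 6 (Fin.natAdd 2 (Fin.natAdd 3 0))) : MvPolynomial (Fin (6 + (2 + (3 + 3)))) ℂ)) * X 0 + C ((X (Fin.natAdd 6 (Fin.natAdd 2 (Fin.natAdd 3 1))) : MvPolynomial (Fin (6 + (2 + (3 + 3)))) ℂ)) * X 1 + C ((X (Fin.natAdd 6 (Fin.natAdd 2 (Fin.natAdd 3 2))) : MvPolynomial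 (Fin (6 + (2 + (3 + 3)))) ℂ)) * X 2) ^ (ι k).1 2)
    refine ⟨Q, hQ0, fun c r q₁ q₂ => ?_⟩
    have h := hQ (Fin.append c (Fin.append r (Fin.append q₁ q₂)))
    simp only [map_sum, map_mul, map_pow, map_add, map_C, map_X, eval_X, Fin.append_left,
        Fin.append_right] at h
    exact h
  -- (D2) families: 14 parameters each
  have hD2 : ∀ (k : Fin 3) (ι : Fin 9 → DegIdx (Fin 3) 4),
      ∃ Q : MvPolynomial (DegIdx (Fin 3) 4) ℂ, Q ≠ 0 ∧
      ∀ (c : Fin 9 → ℂ) (r : Fin 2 → ℂ) (q₂ : Fin 3 → ℂ), aeval (formCoeff 4 (∑ n : Fin 9, C (c n) *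
        (X ((![1, 0, 0] : Fin 3 → Fin 3) k) + C (r 0) * X k) ^ (ι n).1 0 *
        (X ((![2, 2, 1] : Fin 3 → Fin 3) k) + C (r 1) * X k) ^ (ι n).1 1 *
        (C (q₂ 0) * X 0 + C (q₂ 1) * X 1 + C (q₂ 2) * X 2) ^ (ι n).1 2)) Q = 0 := by
    intro k ι
    have hK : 9 + (2 + 3) < Fintype.card (DegIdx (Fin 3) 4) := by
      rw [card_degIdx_fin_three_four]; norm_num
    obtain ⟨Q, hQ0, hQ⟩ := exists_ne_zero_aeval_formCoeff_map_eq_zero hK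
      (∑ n : Fin 9, C (X (Fin.castAdd (2 + 3) n) : MvPolynomial (Fin (9 + (2 + 3))) ℂ) *
        (X ((![1, 0, 0] : Fin 3 → Fin 3) k) + C (X (Fin.natAdd 9 (Fin.castAdd 3 0)) : MvPolynomial (Fin (9 + (2 + 3))) ℂ) * X k) ^ (ι n).1 0 *
        (X ((![2, 2, 1] : Fin 3 → Fin 3) k) + C (X (Fin.natAdd 9 (Fin.castAdd 3 1)) : MvPolynomial (Fin (9 + (2 + 3))) ℂ) * X k) ^ (ι n).1 1 *
        (C ((X (Fin.natAdd 9 (Fin.natAdd 2 0)) : MvPolynomial (Fin (9 + (2 + 3))) ℂ)) * X 0 + C ((X (Fin.natAdd 9 (Fin.natAdd 2 1)) : MvPolynomial (Fin (9 + (2 + 3))) ℂ)) * X 1 + C ((X (Fin.natAdd 9 (Fin.natAdd 2 2)) : MvPolynomial (Fin (9 + (2 + 3))) ℂ)) * X 2) ^ (ι n).1 2)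
    refine ⟨Q, hQ0, fun c r q₂ => ?_⟩
    have h := hQ (Fin.append c (Fin.append r q₂))
    simp only [map_sum, map_mul, map_pow, map_add, map_C, map_X, eval_X, Fin.append_left,
        Fin.append_right] at h
    exact h
  -- the genericity polynomial
  obtain ⟨QU1, hQU1ne, hQU1⟩ := hU1
  obtain ⟨QU2, hQU2ne, hQU2⟩ := hU2
  choose QD3 hQD3ne hQD3 using hD3
  choose QD2 hQD2ne hQD2 using hD2
  refine ⟨(∏ p, ∏ ι, QD3 p ι) * (∏ k, ∏ ι, QD2 k ι) * QU1 * QU2,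
    mul_ne_zero (mul_ne_zero (mul_ne_zero
      (Finset.prod_ne_zero_iff.mpr fun p _ => Finset.prod_ne_zero_iff.mpr fun ι _ => hQD3ne p ι)
      (Finset.prod_ne_zero_iff.mpr fun k _ => Finset.prod_ne_zero_iff.mpr fun ι _ => hQD2ne k ι))
      hQU1ne) hQU2ne, fun f hf hFf => ?_⟩
  -- off the zero set, `f` lies in no family
  have hfD3 : ∀ p ι, aeval (formCoeff 4 f) (QD3 p ι) ≠ 0 := by
    intro p ι h
    apply hFf
    have h' : aeval (formCoeff 4 f) (∏ p, ∏ ι, QD3 p ι) = 0 := by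
      rw [map_prod]
      exact Finset.prod_eq_zero (Finset.mem_univ p)
        (by rw [map_prod]; exact Finset.prod_eq_zero (Finset.mem_univ ι) h)
    rw [map_mul, map_mul, map_mul, h', zero_mul, zero_mul, zero_mul]
  have hfD2 : ∀ k ι, aeval (formCoeff 4 f) (QD2 k ι) ≠ 0 := by
    intro k ι h
    apply hFf
    have h' : aeval (formCoeff 4 f) (∏ k, ∏ ι, QD2 k ι) = 0 := by
      rw [map_prod]
      exact Finset.prod_eq_zero (Finset.mem_univ k)
        (by rw [map_prod]; exact Finset.prod_eq_zero (Finset.mem_univ ι) h)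
    rw [map_mul, map_mul, map_mul, h', mul_zero, zero_mul, zero_mul]
  have hfU1 : aeval (formCoeff 4 f) QU1 ≠ 0 := by
    intro h; apply hFf; rw [map_mul, map_mul, h, mul_zero, zero_mul]
  have hfU2 : aeval (formCoeff 4 f) QU2 ≠ 0 := by
    intro h; apply hFf; rw [map_mul, h, mul_zero]
  -- `f ≠ 0` (the zero form lies in the (U2) family)
  have hf0 : f ≠ 0 := by
    intro h0
    apply hfU2
    have h := hQU2 0 0 0 0
    simp only [Pi.zero_apply, map_zero, zero_mul, zero_add] at h
    rw [h0]
    exact h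
  -- every stabilizer element is a scalar `ζ I`, `ζ⁴ = 1`
  intro γ hγ
  rw [mem_linStabilizer, linSubstRep_apply] at hγ
  by_contra hne
  push Not at hne
  have hns : ∀ cst : ℂ, (γ : Matrix (Fin 3) (Fin 3) ℂ) ≠ cst • (1 : Matrix (Fin 3) (Fin 3) ℂ) := by
    intro cst hc
    apply hne cst _ hc
    rw [hc, linSubst_smul_eq_pow_smul hf, linSubst_one, AlgHom.id_apply] at hγ
    have h1 : (cst ^ 4 - 1) • f = 0 := by rw [sub_smul, one_smul, hγ, sub_self]
    rcases smul_eq_zero.mp h1 with h2 | h2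
    · exact sub_eq_zero.mp h2
    · exact absurd h2 hf0
  have hγdet : (γ : Matrix (Fin 3) (Fin 3) ℂ).det ≠ 0 := (Matrix.isUnits_det_units γ).ne_zero
  obtain ⟨P, hP, hcases⟩ := exists_conj_normalForm_fin_three _ hγdet hns
  rcases hcases with ⟨l₀, l₁, l₂, h01, h02, h12, hgP⟩ | ⟨l, μ, hlμ, hgP⟩ | ⟨μ, l, a, b, hb, hgP⟩ |
      ⟨l, hgP⟩
  · -- (D3)
    obtain ⟨P', p, hP', hgP', hp⟩ := exists_conj_col_zero_eq_one hP hgP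
    obtain ⟨hl₀, hl₁, hl₂⟩ := diag_ne_zero_of_conj hγdet hP' hgP'
    obtain ⟨hTg, hPg⟩ := linSubst_inv_of_mul_eq_mul_fin_three hP' hgP' hγ
    have hg4 : (linSubst (Fin 3) ℂ P'⁻¹ f).IsHomogeneous 4 := linSubst_isHomogeneous _ hf
    have hcard := card_support_le_six_of_diagonal hg4 hl₀ hl₁ hl₂ h01 h02 h12 hTg
    obtain ⟨ι, c, r, q₁, q₂, hfeq⟩ := cover_diagonal_three hg4 P' hPg.symm hcard p hp
    exact hfD3 p ι (by rw [hfeq]; exact hQD3 p ι c r q₁ q₂)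
  · -- (D2)
    obtain ⟨P', k, hP', hgP', h1, h2, h3, h4⟩ := exists_conj_two_cols_reduced hP hgP
    obtain ⟨hl, -, hμ⟩ := diag_ne_zero_of_conj hγdet hP' hgP'
    obtain ⟨hTg, hPg⟩ := linSubst_inv_of_mul_eq_mul_fin_three hP' hgP' hγ
    have hg4 : (linSubst (Fin 3) ℂ P'⁻¹ f).IsHomogeneous 4 := linSubst_isHomogeneous _ hf
    have hcard := card_support_le_nine_of_diagonal hg4 hl hμ hlμ hTg
    obtain ⟨ι, c, r, q₂, hfeq⟩ := cover_diagonal_pair hg4 P' hPg.symm hcard k h1 h2 h3 h4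
    exact hfD2 k ι (by rw [hfeq]; exact hQD2 k ι c r q₂)
  · -- (U1)
    obtain ⟨hμ, hl, -⟩ := diag_ne_zero_of_conj hγdet hP hgP
    obtain ⟨hTg, hPg⟩ := linSubst_inv_of_mul_eq_mul_fin_three hP hgP hγ
    have hg4 : (linSubst (Fin 3) ℂ P⁻¹ f).IsHomogeneous 4 := linSubst_isHomogeneous _ hf
    have hsupp := apply_two_eq_zero_of_jordan_smul (a := a) hμ hl hb 4 _ 1 hg4
      (by rw [one_smul]; exact hTg)
    obtain ⟨c, q₀, q₁, hfeq⟩ := cover_jordan_two hg4 P hPg.symm hsupp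
    exact hfU1 (by rw [hfeq]; exact hQU1 c q₀ q₁)
  · -- (U2)
    obtain ⟨hl, -, -⟩ := diag_ne_zero_of_conj hγdet hP hgP
    obtain ⟨hTg, hPg⟩ := linSubst_inv_of_mul_eq_mul_fin_three hP hgP hγ
    have hg4 : (linSubst (Fin 3) ℂ P⁻¹ f).IsHomogeneous 4 := linSubst_isHomogeneous _ hf
    by_cases hl4 : l ^ 4 = 1
    · have hT : (!![l, l, 0; 0, l, l; 0, 0, l] : Matrix (Fin 3) (Fin 3) ℂ) =
          l • !![1, 1, 0; 0, 1, 1; 0, 0, 1] := by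
        ext i j; fin_cases i <;> fin_cases j <;> simp
      rw [hT, linSubst_smul_eq_pow_smul hg4, hl4, one_smul] at hTg
      obtain ⟨c₁, c₂, c₃, hgeq⟩ := exists_eq_of_unipotent_fixed_quartic hg4 hTg
      obtain ⟨c, q₀, q₁, q₂, hfeq⟩ := cover_jordan_three P hPg.symm hgeq
      exact hfU2 (by rw [hfeq]; exact hQU2 c q₀ q₁ q₂)
    · have hg0 := eq_zero_of_smul_unipotent_smul hl 4 _ 1 hg4 (by rw [one_smul]; exact hTg)
        (Ne.symm hl4)
      apply hf0
      rw [← hPg, hg0, map_zero]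

/-- **Corollary: generic stabilizer period of ternary quartics** — for a Zariski-generic
`f ∈ Sym⁴ ℂ³`: trivial stabilizer, `a(f) = 4 / gcd(4,3) = 4` and `a'(f) = 1` (the corrected
`(4,3)` clause of BI 2017 Thm. 2.3; from the tree's `stabilizerPeriod_eq_of_hasTrivialStabilizer`
/ `reducedStabilizerPeriod_eq_one_of_hasTrivialStabilizer`). [cite: BurgisserIkenmeyer2017, Thm. 2.3] -/
theorem isZariskiGeneric_ternaryQuartic_trivialStabilizer_period :
    IsZariskiGeneric 4 (fun f : MvPolynomial (Fin 3) ℂ =>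
      HasTrivialStabilizer 4 f ∧ stabilizerPeriod f = 4 ∧ reducedStabilizerPeriod 4 f = 1) := by
  obtain ⟨F, hF0, hF⟩ := isZariskiGeneric_hasTrivialStabilizer_ternaryQuartic
  refine ⟨F, hF0, fun f hf hFf => ?_⟩
  have htriv := hF f hf hFf
  refine ⟨htriv, ?_, reducedStabilizerPeriod_eq_one_of_hasTrivialStabilizer hf (by norm_num) htriv⟩
  have h := stabilizerPeriod_eq_of_hasTrivialStabilizer hf (by norm_num) htriv
  simpa using h

end Main

end Literature.Computability.AlgebraicComplexity
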